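import Literature.NumberTheory.EllipticCurves.LocalPointsNonsingularReductionDivisibleProofs
import Literature.NumberTheory.EllipticCurves.LocalPointsIntegersSubgroup
import Literature.NumberTheory.EllipticCurves.TamagawaSubgroupProofs
import Literature.NumberTheory.EllipticCurves.SelmerFiniteProofs
import Literature.NumberTheory.EllipticCurves.KodairaNeronUnramifiedInertiaProofs
import Literature.NumberTheory.EllipticCurves.InertiaInvariantsKodairaNeronAdditiveProofs
import Literature.NumberTheory.EllipticCurves.InertiaFixedTorsionAdditiveIndexBoundProofs
import Literature.NumberTheory.EllipticCurves.TamagawaNeZeroProofs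
import HarnessLib

/-!
# A prime `p ∣ c_v = [E(K_v) : E₀(K_v)]`, `v ∤ p`: an inertia-fixed `p`-torsion point OFF `E₀`
# (`E(K_v^nr)[p] ⊄ E₀`; theorems only)

`Proofs` file (theorems only: no definition, no named fact, no instance), topic
`NumberTheory/EllipticCurves`.  The EXISTENCE companion of `InertiaFixedTorsionAdditiveIndexBoundProofs`
("an inertia-fixed subgroup of `E[p]` has `≤ 4` points at an additive `v ∤ p`"): if the prime `p`, with
`v ∤ p`, divides the local Tamagawa number `c_v = [E(K_v) : E₀(K_v)]` at a place `v` of BAD reduction,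
then some `p`-torsion point of `E(K̄_v)` fixed by the inertia group `I_𝔐 ≤ Γ_{K_v}` does NOT lie in
`E₀` (in particular it is `≠ O`).  Proof (Silverman *AEC* VII.2.1–2.2, VII.3.1, VII.6; Greenberg LNM 1716
§2): a `K_v`-rational `P ∉ E₀(K_v)` with `p • P ∈ E₀(K_v)` exists (an element of order `p` of the finite
group `E(K_v)/E₀(K_v)`); `E₀(K_v^nr)` is `p`-divisible (the tree's
`exists_nsmul_eq_of_reducesToNonsingular_of_forall_inertia`, `LocalPointsNonsingularReductionDivisibleProofs`),
so `p • P = p • Q` with `Q ∈ E₀(K_v^nr)`; then `R = P − Q` is `p`-torsion, inertia-fixed, and `R ∉ E₀`.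

* `WeierstrassCurve.exists_torsion_not_reducesToNonsingular_of_dvd_index` — LOCAL, in the setting of
  `LocalPointsNonsingularReductionDivisibleProofs` (`M = W.localMinimalIntegralModel v`, `V = (M ⊗ K_v) ⊗ K̄_v`,
  `E₀` = `ReducesToNonsingular |·|_v`): `p ∣ [M(K_v) : E₀(K_v)] ≠ 0` ⇒ some `R ∈ V(K̄_v)` with
  `p • R = O`, `R` fixed by `I_𝔐`, `R ∉ E₀`.
* `WeierstrassCurve.exists_ne_zero_geomTorsion_absInertia_fixed_of_dvd_localTamagawaNumber` — GLOBAL: for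
  `E/K`, `v` bad, `p` prime, `v ∤ p`, `p ∣ c_v`: some `P ∈ E[p] ≤ E(K̄)`, `P ≠ O`, fixed by
  `absInertia K_v` (through `absGaloisRestrict K K_v`).
* `WeierstrassCurve.exists_line_geomTorsion_three_absInertia_fixed_of_dvd_localTamagawaNumber` — `p = 3`,
  `v` ADDITIVE, `3 ∣ c_v`: the inertia-fixed points of `E[3]` form a subgroup of EXACTLY `3` elements (with
  `InertiaFixedTorsionAdditiveIndexBoundProofs`: "at most a line").

Consumer (cell `bsd-ssimc`, crux `KobayashiLowerHalfLargeImage`, item stmt-BirchSwinnertonDyer-19001,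
line `shadow_seed`, `p = 3`): with `InertiaFixedTorsionAdditiveIndexBoundProofs` this gives "at an
additive `v ∤ 3` with `3 ∣ c_v` (Kodaira `IV`/`IV*` with `c_v = 3`) the inertia invariants `E[3]^{I_v}`
are EXACTLY a line, meeting `E₀` trivially" — the inertia half of the line's local lemma at every shadow
prime of its census (all have `c_q = 3`).  The Frobenius characters are NOT treated here.  Nothing is
asserted about any curve; BSD is not proved by any of this.

## References

* [SilvermanAEC2009] J. H. Silverman, *The Arithmetic of Elliptic Curves*, 2nd ed., GTM 106 (2009):
  Props. VII.2.1, VII.2.2, VII.3.1 (PDF pp. 166–171), Thm. VII.6.1 and Cor. VII.6.2 (PDF p. 177).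
* [GreenbergLNM1716] R. Greenberg, *Iwasawa theory for elliptic curves*, LNM 1716 (1999), §2 (`ℓ ≠ p`),
  §3 p. 88 ("`c_v^{(p)} = |E(F_v)_p|`" at additive `v`).

Design: no definitions; one universe `u`; the `𝒪_w`-model `W₀ = M.map φ₀` and the comparison of
`E₀(K_v)` with `E₀` over `𝒪_w` on `K_v`-points follow `MazurTorsionStepFourProofs` (step (ii)) verbatim.
-/

noncomputable section

open scoped Classical NNReal Pointwise
open NumberField IsDedekindDomain

universe u

namespace WeierstrassCurve

open Literature.NumberTheory.EllipticCurves Literature.NumberTheory.GaloisRepresentations Field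
  IsDedekindDomain.HeightOneSpectrum

variable {K : Type u} [Field K] [NumberField K] (W : WeierstrassCurve K) {v : HeightOneSpectrum (𝓞 K)}
  {w : Valuation (AlgebraicClosure (v.adicCompletion K)) ℝ≥0}
  (hw : ∀ x, (w x : ℝ) = spectralNorm (v.adicCompletion K) (AlgebraicClosure (v.adicCompletion K)) x)

include hw in
/-- **`p ∣ [E(K_v) : E₀(K_v)]`, `v ∤ p`, bad reduction ⇒ an inertia-fixed `p`-torsion point off `E₀`.**
Let `E/K` be an elliptic curve over a number field, `v` a finite place of BAD reduction,
`M = W.localMinimalIntegralModel v` its minimal model, `V = (M ⊗ K_v) ⊗ K̄_v`, `w = |·|_v` the spectral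
valuation, `𝔐` the prime of `\bar 𝓞_v` above `𝓂_v` with inertia group `I_𝔐 ≤ Γ_{K_v}`, and `p` a prime
with `v ∤ p` dividing the (finite, non-zero) index of `E₀(K_v)` (`M.nonsingularReductionSubgroup`) in
`M(K_v)`.  Then some `R ∈ V(K̄_v)` has `p • R = O`, is fixed by every `τ ∈ I_𝔐`, and does NOT reduce to a
nonsingular point (`¬ ReducesToNonsingular`; in particular `R ≠ O`).  Proof: `P ∈ M(K_v) ∖ E₀` with
`p • P ∈ E₀` (an element of order `p` of `M(K_v)/E₀`), read in `V` (fixed by `Γ_{K_v}`, off `E₀` over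
`𝒪_w`: `MazurTorsionStepFourProofs` step (ii)); `p • P = p • Q` with `Q ∈ E₀(K_v^nr)`
(`exists_nsmul_eq_of_reducesToNonsingular_of_forall_inertia`); `R = P − Q`.
[cite: SilvermanAEC2009, Props. VII.2.1–2.2 and VII.3.1 (PDF pp. 166–171), Thm. VII.6.1 (PDF p. 177)]
[cite: GreenbergLNM1716, §2 Prop. 2.1 and §3 p. 88] -/
theorem exists_torsion_not_reducesToNonsingular_of_dvd_index [W.IsElliptic]
    {𝔐 : Ideal v.localAbsIntegers} (h𝔐 : 𝔐 ∈ v.localPrimesAbove) (hbad : ¬ W.HasGoodReductionAt v)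
    {p : ℕ} (hp : p.Prime) (hpv : (p : 𝓞 K) ∉ v.asIdeal)
    (hdvd : p ∣ ((W.localMinimalIntegralModel v).nonsingularReductionSubgroup
      (integers_valuationRing_valuation (v.adicCompletionIntegers K) (v.adicCompletion K))).index)
    (h0 : ((W.localMinimalIntegralModel v).nonsingularReductionSubgroup
      (integers_valuationRing_valuation (v.adicCompletionIntegers K) (v.adicCompletion K))).index ≠ 0) :
    ∃ R : (((W.localMinimalIntegralModel v).map (algebraMap (v.adicCompletionIntegers K)
        (v.adicCompletion K))).baseChange (AlgebraicClosure (v.adicCompletion K))).toAffine.Point,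
      p • R = 0 ∧
      (∀ τ ∈ 𝔐.inertia (absoluteGaloisGroup (v.adicCompletion K)),
        Affine.Point.map ((absoluteGaloisGroup.toAlgEquiv (v.adicCompletion K) τ :
            AlgebraicClosure (v.adicCompletion K) ≃ₐ[v.adicCompletion K]
              AlgebraicClosure (v.adicCompletion K)) :
            AlgebraicClosure (v.adicCompletion K) →ₐ[v.adicCompletion K]
              AlgebraicClosure (v.adicCompletion K)) R = R) ∧
      ¬ ReducesToNonsingular w (IsLocalRing.residue w.integer) R := by
  haveI hV := isIntegral_spectralValuation_baseChange hw (W.localMinimalIntegralModel v)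
  set M := W.localMinimalIntegralModel v with hM
  haveI := W.isElliptic_map_localMinimalIntegralModel (v := v)
  haveI := W.isElliptic_baseChange_map_localMinimalIntegralModel (v := v)
  haveI : Fact p.Prime := ⟨hp⟩
  have hv0 : w.Integers w.integer := Valuation.integer.integers w
  have hvR := integers_valuationRing_valuation (v.adicCompletionIntegers K) (v.adicCompletion K)
  set H := M.nonsingularReductionSubgroup hvR with hH
  /- (1) a `K_v`-rational point `P ∉ E₀` with `p • P ∈ E₀` -/
  haveI hfinQ : Finite ((M.baseChange (v.adicCompletion K)).toAffine.Point ⧸ H) :=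
    Nat.finite_of_card_ne_zero (by rw [← AddSubgroup.index_eq_card]; exact h0)
  obtain ⟨q, hq⟩ := exists_prime_addOrderOf_dvd_card'
    (G := (M.baseChange (v.adicCompletion K)).toAffine.Point ⧸ H) p
    (by rw [← AddSubgroup.index_eq_card]; exact hdvd)
  obtain ⟨P, rfl⟩ := QuotientAddGroup.mk_surjective q
  have hPH : P ∉ H := fun h ↦ by
    have h1 : (QuotientAddGroup.mk P : _ ⧸ H) = 0 := (QuotientAddGroup.eq_zero_iff P).mpr h
    rw [h1, addOrderOf_zero] at hq
    exact hp.one_lt.ne hq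
  have hpPH : p • P ∈ H := by
    refine (QuotientAddGroup.eq_zero_iff _).mp ?_
    rw [QuotientAddGroup.mk_nsmul, ← hq]
    exact addOrderOf_nsmul_eq_zero _
  /- (2) the `𝒪_w`-model `W₀ = M.map φ₀` (as in `MazurTorsionStepFourProofs`) -/
  set f : v.adicCompletionIntegers K →+* AlgebraicClosure (v.adicCompletion K) :=
    (algebraMap (v.adicCompletion K) (AlgebraicClosure (v.adicCompletion K))).comp
      (algebraMap (v.adicCompletionIntegers K) (v.adicCompletion K)) with hfdef
  have hfle : ∀ a, f a ∈ w.integer := fun a ↦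
    (spectralValuation_algebraMap_le_one_iff hw _).mpr a.2
  set φ₀ : v.adicCompletionIntegers K →+* w.integer := f.codRestrict w.integer hfle with hφ₀def
  have hφ₀ : ∀ a, ((φ₀ a : w.integer) : AlgebraicClosure (v.adicCompletion K)) = f a := fun a ↦ rfl
  haveI hφ₀loc : IsLocalHom φ₀ := ⟨fun a ha ↦ by
    by_contra hna
    have hmem : a ∈ IsLocalRing.maximalIdeal (v.adicCompletionIntegers K) :=
      (IsLocalRing.mem_maximalIdeal _).mpr (mem_nonunits_iff.mpr hna)
    have hlt : w (f a) < 1 := spectralValuation_algebraMap_lt_one_of_mem_maximalIdeal hw h𝔐 hmem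
    have h1 : w (f a) = 1 := by
      rw [← hφ₀]; exact (hv0.isUnit_iff_valuation_eq_one).mp ha
    exact absurd h1 hlt.ne⟩
  set W₀ : WeierstrassCurve w.integer := M.map φ₀ with hW₀def
  have hX : (M.baseChange (v.adicCompletion K)).baseChange (AlgebraicClosure (v.adicCompletion K)) =
      W₀.baseChange (AlgebraicClosure (v.adicCompletion K)) := by
    rw [hW₀def]
    change (M.map _).map _ = (M.map φ₀).map (algebraMap w.integer _)
    rw [map_map, map_map]
    congr 1
  haveI hint : ((M.baseChange (v.adicCompletion K)).baseChange
      (AlgebraicClosure (v.adicCompletion K))).IsIntegral w.integer := ⟨W₀, hX⟩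
  have hκ : W₀.map (IsLocalRing.residue w.integer) =
      ((M.map (IsLocalRing.residue (v.adicCompletionIntegers K))).map
        (IsLocalRing.ResidueField.map φ₀)) := by
    rw [hW₀def]
    simp only [map_map]
    congr 1
  have hE₀iff : ∀ T : ((M.baseChange (v.adicCompletion K)).baseChange
      (AlgebraicClosure (v.adicCompletion K))).toAffine.Point,
      ReducesToNonsingular w (IsLocalRing.residue w.integer) T ↔
        W₀.HasNonsingularReduction (Affine.Point.congrEquiv hX T) := fun T ↦ by
    rw [← reducesToNonsingular_iff_hasNonsingularReduction W₀,
      WeierstrassCurve.reducesToNonsingular_congrEquiv_iff w _ hX T]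
  /- (3) `K_v`-points read in `V`: fixed by `Γ_{K_v}`, and `E₀(K_v) = E₀ ∩ M(K_v)` -/
  set ι : v.adicCompletion K →ₐ[v.adicCompletion K] AlgebraicClosure (v.adicCompletion K) :=
    Algebra.ofId (v.adicCompletion K) (AlgebraicClosure (v.adicCompletion K)) with hιdef
  set j := Affine.Point.map (W' := (M.baseChange (v.adicCompletion K)).toAffine)
    (S := v.adicCompletion K) ι with hjdef
  have hjfix : ∀ (σ : AlgebraicClosure (v.adicCompletion K) →ₐ[v.adicCompletion K]
      AlgebraicClosure (v.adicCompletion K)) (T : (M.baseChange (v.adicCompletion K)).toAffine.Point),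
      Affine.Point.map σ (j T) = j T := by
    intro σ T
    rw [hjdef, Affine.Point.map_map]
    have hσι : σ.comp ι = ι := AlgHom.ext fun x ↦ by
      rw [AlgHom.comp_apply, hιdef, Algebra.ofId_apply, AlgHom.commutes]
    rw [hσι]
  have hbridge : ∀ T : (M.baseChange (v.adicCompletion K)).toAffine.Point,
      ReducesToNonsingular w (IsLocalRing.residue w.integer) (j T) ↔ T ∈ H := by
    intro T
    rw [hH, mem_nonsingularReductionSubgroup_iff, hE₀iff]
    rcases point_cases hvR T with rfl | ⟨x, y, h, rfl, hx⟩ | ⟨a, c, h, rfl⟩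
    · have hj0 : j (0 : ((M.baseChange (v.adicCompletion K)).baseChange (v.adicCompletion K)).toAffine.Point) = 0 :=
        map_zero j
      show W₀.HasNonsingularReduction (Affine.Point.congrEquiv hX
        (j (0 : ((M.baseChange (v.adicCompletion K)).baseChange (v.adicCompletion K)).toAffine.Point))) ↔ _
      rw [hj0, map_zero]
      exact iff_of_true hasNonsingularReduction_zero hasNonsingularReduction_zero
    · have hxO : x ∉ v.adicCompletionIntegers K := fun hxO ↦
        (not_mem_range_iff hvR).mpr hx ⟨⟨x, hxO⟩, rfl⟩
      have hιx : 1 < w (ι x) := by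
        rw [hιdef, Algebra.ofId_apply]
        exact not_le.mp fun hle ↦ hxO ((spectralValuation_algebraMap_le_one_iff hw x).mp hle)
      refine iff_of_true ?_ (Or.inl ((not_mem_range_iff hvR).mpr hx))
      have h' : ((M.baseChange (v.adicCompletion K)).baseChange (v.adicCompletion K)).toAffine.Nonsingular
          x y := h
      show W₀.HasNonsingularReduction (Affine.Point.congrEquiv hX (j (.some _ _ h')))
      rw [hjdef, Affine.Point.map_some, Affine.Point.congrEquiv_some]
      exact Or.inl ((not_mem_range_iff hv0).mpr hιx)
    · rw [hasNonsingularReduction_some_algebraMap_iff hvR.hom_inj h]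
      have h' : ((M.baseChange (v.adicCompletion K)).baseChange (v.adicCompletion K)).toAffine.Nonsingular
          (algebraMap (v.adicCompletionIntegers K) (v.adicCompletion K) a)
          (algebraMap (v.adicCompletionIntegers K) (v.adicCompletion K) c) := h
      show W₀.HasNonsingularReduction (Affine.Point.congrEquiv hX (j (.some _ _ h'))) ↔ _
      rw [hjdef, Affine.Point.map_some, Affine.Point.congrEquiv_some]
      refine (hasNonsingularReduction_some_algebraMap_iff hv0.hom_inj (a := φ₀ a) (b := φ₀ c) _).trans ?_
      rw [hκ, ← IsLocalRing.ResidueField.map_residue, ← IsLocalRing.ResidueField.map_residue,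
        Affine.map_nonsingular _ (IsLocalRing.ResidueField.map φ₀).injective]
  /- (4) divide `p • P` in `E₀(K_v^nr)` and subtract -/
  have hpunit : IsUnit ((p : ℕ) : v.adicCompletionIntegers K) := by
    refine (LocalPoints.isUnit_iff_valuation_eq_one v (p : v.adicCompletionIntegers K)).mpr ?_
    have h1 := LocalPoints.valuation_natCast_eq_one (K := K) v hpv
    simpa using h1
  -- the rational point read in `V`
  set P' : ((M.baseChange (v.adicCompletion K)).baseChange
      (AlgebraicClosure (v.adicCompletion K))).toAffine.Point := j P with hP'def
  have hP'fix : ∀ σ : AlgebraicClosure (v.adicCompletion K) →ₐ[v.adicCompletion K]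
      AlgebraicClosure (v.adicCompletion K), Affine.Point.map σ P' = P' := fun σ ↦ hjfix σ P
  have hpPE₀ : ReducesToNonsingular w (IsLocalRing.residue w.integer) (p • P') := by
    have h := (hbridge (p • P)).mpr hpPH
    have e : j (p • P) = p • P' := map_nsmul j p P
    rw [e] at h
    exact h
  have hpP'fix : ∀ σ : AlgebraicClosure (v.adicCompletion K) →ₐ[v.adicCompletion K]
      AlgebraicClosure (v.adicCompletion K), Affine.Point.map σ (p • P') = p • P' := fun σ ↦
    (map_nsmul (Affine.Point.map σ) p P').trans (congrArg (fun T ↦ p • T) (hP'fix σ))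
  obtain ⟨Q, hQE₀, hQI, hQp⟩ := W.exists_nsmul_eq_of_reducesToNonsingular_of_forall_inertia hw h𝔐 hbad
    hpunit hpPE₀ (fun τ _ ↦ hpP'fix _)
  -- read `Q` at the type of `P'`
  set Q' : ((M.baseChange (v.adicCompletion K)).baseChange
      (AlgebraicClosure (v.adicCompletion K))).toAffine.Point := Q with hQ'def
  have hQ'E₀ : ReducesToNonsingular w (IsLocalRing.residue w.integer) Q' := hQE₀
  have hQ'I : ∀ τ ∈ 𝔐.inertia (absoluteGaloisGroup (v.adicCompletion K)),
      Affine.Point.map ((absoluteGaloisGroup.toAlgEquiv (v.adicCompletion K) τ :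
          AlgebraicClosure (v.adicCompletion K) ≃ₐ[v.adicCompletion K]
            AlgebraicClosure (v.adicCompletion K)) :
          AlgebraicClosure (v.adicCompletion K) →ₐ[v.adicCompletion K]
            AlgebraicClosure (v.adicCompletion K)) Q' = Q' := fun τ hτ ↦ hQI τ hτ
  have hQ'p : p • Q' = p • P' := hQp
  refine ⟨P' - Q', ?_, fun τ hτ ↦ ?_, fun hR ↦ hPH ?_⟩
  · show p • (P' - Q') = (0 : ((M.baseChange (v.adicCompletion K)).baseChange
      (AlgebraicClosure (v.adicCompletion K))).toAffine.Point)
    rw [nsmul_sub, hQ'p, sub_self]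
  · show Affine.Point.map ((absoluteGaloisGroup.toAlgEquiv (v.adicCompletion K) τ :
          AlgebraicClosure (v.adicCompletion K) ≃ₐ[v.adicCompletion K]
            AlgebraicClosure (v.adicCompletion K)) :
          AlgebraicClosure (v.adicCompletion K) →ₐ[v.adicCompletion K]
            AlgebraicClosure (v.adicCompletion K)) (P' - Q') = P' - Q'
    rw [map_sub, hP'fix, hQ'I τ hτ]
  · have hR' : ReducesToNonsingular w (IsLocalRing.residue w.integer) (P' - Q') := hR
    have hP'E₀ : ReducesToNonsingular w (IsLocalRing.residue w.integer) P' := by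
      refine (hE₀iff P').mpr ?_
      rw [show P' = (P' - Q') + Q' from (sub_add_cancel P' Q').symm, map_add]
      exact ((hE₀iff _).mp hR').add hv0 ((hE₀iff _).mp hQ'E₀)
    exact (hbridge P).mp hP'E₀

/-! ### The statements on `E[p] ≤ E(K̄)` for an elliptic curve over a number field -/

/-- Transport of the index of `E₀` along an equality of Weierstrass equations. [folklore] -/
private theorem index_goodReductionSubgroup_eq_of_eq {R : Type*} [CommRing R] [IsDomain R]
    [IsDiscreteValuationRing R] {L : Type*} [Field L] [Algebra R L] [IsFractionRing R L]
    {Y₁ Y₂ : WeierstrassCurve L} (h : Y₁ = Y₂) [Y₁.IsMinimal R] [Y₂.IsMinimal R] :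
    (Y₁.goodReductionSubgroup R).index = (Y₂.goodReductionSubgroup R).index := by
  subst h; rfl

/-- `congrEquiv` along `X₁ = X₂` commutes with the Galois action on `K̄_v`-points. [folklore] -/
private theorem congrEquiv_map_eq {F : Type*} [Field F] {L : Type*} [Field L] [Algebra F L]
    {X₁ X₂ : WeierstrassCurve F} (h : X₁ = X₂) (h' : X₁.baseChange L = X₂.baseChange L)
    (σ : L →ₐ[F] L) (P : (X₁.baseChange L).toAffine.Point) :
    Affine.Point.congrEquiv h' (Affine.Point.map (W' := X₁) σ P) =
      Affine.Point.map (W' := X₂) σ (Affine.Point.congrEquiv h' P) := by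
  subst h; rfl

/-- **`p ∣ c_v`, `v ∤ p`, bad reduction ⇒ a non-zero `p`-torsion point of `E(K̄)` fixed by the local
inertia group.**  For an elliptic curve `E/K` over a number field, a finite place `v` of bad reduction, a
prime `p` with `v ∤ p` dividing the local Tamagawa number `c_v = [E(K_v) : E₀(K_v)]`
(`localTamagawaNumber`), there is `P ∈ E[p] = geomTorsion W p`, `P ≠ O`, fixed by the inertia group
`absInertia K_v ≤ Γ_{K_v}` acting through `absGaloisRestrict K K_v`.  (Greenberg: "`c_v^{(p)} = |E(F_v)_p|`";
here only the existence half, via `exists_torsion_not_reducesToNonsingular_of_dvd_index` and the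
transport `E[p] ≅ E(K̄_v)[p]` along the chosen embedding `K̄ → K̄_v`.)
[cite: GreenbergLNM1716, §3 p. 88 and Prop. 3.8 (proof, p. 96)]
[cite: SilvermanAEC2009, Thm. VII.6.1 and Cor. VII.6.2 (PDF p. 177)] -/
theorem exists_ne_zero_geomTorsion_absInertia_fixed_of_dvd_localTamagawaNumber [W.IsElliptic]
    (hbad : ¬ W.HasGoodReductionAt v) {p : ℕ} (hp : p.Prime) (hpv : (p : 𝓞 K) ∉ v.asIdeal)
    (hdvd : p ∣ (W.baseChange (v.adicCompletion K)).localTamagawaNumber (v.adicCompletionIntegers K)) :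
    ∃ P : geomPoints W, P ≠ 0 ∧ P ∈ geomTorsion W (p : ℤ) ∧
      ∀ σ ∈ absInertia (v.adicCompletion K), absGaloisRestrict K (v.adicCompletion K) σ • P = P := by
  obtain ⟨w, hw⟩ := v.exists_spectralValuation
  obtain ⟨𝔐, h𝔐⟩ := v.localPrimesAbove_nonempty
  set X := W.localMinimalModel v with hXdef
  haveI : X.IsElliptic := W.isElliptic_localMinimalModel v
  haveI : PerfectField (IsLocalRing.ResidueField (v.adicCompletionIntegers K)) := PerfectField.ofFinite
  have hX₀K : (W.localMinimalIntegralModel v).baseChange (v.adicCompletion K) = X :=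
    baseChange_integralModel_eq (v.adicCompletionIntegers K) X
  haveI hminM : ((W.localMinimalIntegralModel v).baseChange (v.adicCompletion K)).IsMinimal
      (v.adicCompletionIntegers K) := by rw [hX₀K]; infer_instance
  -- `c_v` is the index of `E₀(K_v)` on the integral minimal model
  have hvR := integers_valuationRing_valuation (v.adicCompletionIntegers K) (v.adicCompletion K)
  have hindex : (W.baseChange (v.adicCompletion K)).localTamagawaNumber (v.adicCompletionIntegers K) =
      ((W.localMinimalIntegralModel v).nonsingularReductionSubgroup hvR).index := by
    rw [localTamagawaNumber_baseChange_eq, ← goodReductionSubgroup_baseChange_eq,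
      index_goodReductionSubgroup_eq_of_eq hX₀K.symm]
  have h0 : (W.baseChange (v.adicCompletion K)).localTamagawaNumber (v.adicCompletionIntegers K) ≠ 0 := by
    rw [localTamagawaNumber_baseChange_eq]
    exact index_goodReductionSubgroup_ne_zero_of_finite_residueField (v.adicCompletionIntegers K) X
  rw [hindex] at hdvd h0
  obtain ⟨R, hpR, hRI, hRE₀⟩ :=
    W.exists_torsion_not_reducesToNonsingular_of_dvd_index hw h𝔐 hbad hp hpv hdvd h0
  have hR0 : R ≠ 0 := fun h ↦ hRE₀ (by rw [h]; exact reducesToNonsingular_zero)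
  -- transport to `X ⊗ K̄_v`, then to `E(K̄_v) = localPoints`, then to `E(K̄)`
  have hVX : ((W.localMinimalIntegralModel v).baseChange (v.adicCompletion K)).baseChange
      (AlgebraicClosure (v.adicCompletion K)) = X.baseChange (AlgebraicClosure (v.adicCompletion K)) := by
    rw [hX₀K]
  set R₁ := Affine.Point.congrEquiv hVX R with hR₁
  obtain ⟨C, hC⟩ := W.exists_variableChange_smul_eq_localMinimalModel v
  obtain ⟨Φ, hΦ⟩ := W.exists_addEquiv_localPoints_of_smul_eq v hC
  set Q₁ : localPoints W (v.adicCompletion K) := Φ.symm R₁ with hQ₁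
  have hΦQ₁ : Φ Q₁ = R₁ := by rw [hQ₁, AddEquiv.apply_symm_apply]
  have hpR₁ : p • R₁ = 0 := by
    rw [hR₁]
    exact ((map_nsmul (Affine.Point.congrEquiv hVX) p R).symm.trans
      (congrArg (Affine.Point.congrEquiv hVX) hpR)).trans (map_zero _)
  have hpQ₁ : p • Q₁ = 0 := Φ.injective (by rw [map_nsmul, hΦQ₁, hpR₁, map_zero])
  have hQ₁I : ∀ σ ∈ absInertia (v.adicCompletion K), σ • Q₁ = Q₁ := by
    intro σ hσ
    rw [← inertia_eq_absInertia hw h𝔐] at hσ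
    apply Φ.injective
    rw [hΦ, hΦQ₁, hR₁]
    exact (congrEquiv_map_eq hX₀K hVX _ R).symm.trans
      (congrArg (Affine.Point.congrEquiv hVX) (hRI σ hσ))
  obtain ⟨P₀, hpP₀, hP₀Q⟩ := exists_pointsMapOfEmb_eq_of_nsmul_eq_zero W
    (closureEmb (K := K) (v.adicCompletion K)) hp.ne_zero hpQ₁
  refine ⟨P₀, fun h0' ↦ hR0 ?_, (mem_geomTorsion_iff W (p : ℤ) P₀).mpr (by rw [natCast_zsmul, hpP₀]),
    fun σ hσ ↦ ?_⟩
  · have hQ0 : Q₁ = 0 := by rw [← hP₀Q, h0', map_zero]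
    have hR₁0 : Affine.Point.congrEquiv hVX R = 0 := by rw [← hR₁, ← hΦQ₁, hQ0, map_zero]
    exact (AddEquiv.map_eq_zero_iff (Affine.Point.congrEquiv hVX)).mp hR₁0
  · apply pointsMapOfEmb_injective W (closureEmb (K := K) (v.adicCompletion K))
    have hres : resGalOfEmb (closureEmb (K := K) (v.adicCompletion K)) σ =
        absGaloisRestrict K (v.adicCompletion K) σ := rfl
    rw [← hres, pointsMapOfEmb_smul, hP₀Q, hQ₁I σ hσ]

/-- **`3 ∣ c_v` at an additive `v ∤ 3` ⇒ `E[3]^{I_v}` is EXACTLY a line.**  For `E/K` elliptic over a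
number field, an additive place `v ∤ 3` with `3 ∣ c_v` (Kodaira type `IV` or `IV*` with `c_v = 3`), there
is a subgroup `A ≤ E[3]` with `#A = 3`, fixed pointwise by the inertia group `absInertia K_v`, and
containing EVERY inertia-fixed point of `E[3]` — existence from
`exists_ne_zero_geomTorsion_absInertia_fixed_of_dvd_localTamagawaNumber`, maximality from the bound
`natCard_dvd_three_of_absInertia_fixed_of_hasAdditiveReductionAt` ("at most a line").  This is the
inertia part of the shape `E[3]|G_{K_v} ≅ (μω ∗; 0 μ)` at a "shadow" prime (line `shadow_seed` of crux
`KobayashiLowerHalfLargeImage`); the characters are not treated here.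
[cite: SilvermanAEC2009, Thm. VII.6.1 (PDF p. 177) and proof of Thm. VII.7.1 (PDF p. 179)]
[cite: SilvermanATAEC1994, Cor. IV.9.2(d) with Table 4.1 (PDF pp. 340, 365)] -/
theorem exists_line_geomTorsion_three_absInertia_fixed_of_dvd_localTamagawaNumber [W.IsElliptic]
    (hadd : W.HasAdditiveReductionAt v) (h3v : (3 : 𝓞 K) ∉ v.asIdeal)
    (hdvd : 3 ∣ (W.baseChange (v.adicCompletion K)).localTamagawaNumber (v.adicCompletionIntegers K)) :
    ∃ A : AddSubgroup (geomPoints W), A ≤ geomTorsion W (3 : ℤ) ∧ Nat.card A = 3 ∧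
      (∀ σ ∈ absInertia (v.adicCompletion K), ∀ P ∈ A,
        absGaloisRestrict K (v.adicCompletion K) σ • P = P) ∧
      ∀ P ∈ geomTorsion W (3 : ℤ), (∀ σ ∈ absInertia (v.adicCompletion K),
        absGaloisRestrict K (v.adicCompletion K) σ • P = P) → P ∈ A := by
  obtain ⟨P₀, hP₀0, hP₀3, hP₀I⟩ :=
    W.exists_ne_zero_geomTorsion_absInertia_fixed_of_dvd_localTamagawaNumber hadd.not_hasGoodReductionAt
      Nat.prime_three (by exact_mod_cast h3v) (by exact_mod_cast hdvd)
  -- the subgroup of ALL inertia-fixed `3`-torsion points has `≤ 3` elements and contains `⟨P₀⟩`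
  set F : AddSubgroup (geomPoints W) :=
    { carrier := {P | P ∈ geomTorsion W (3 : ℤ) ∧ ∀ σ ∈ absInertia (v.adicCompletion K),
        absGaloisRestrict K (v.adicCompletion K) σ • P = P}
      add_mem' := fun {a b} ha hb ↦ ⟨(geomTorsion W (3 : ℤ)).add_mem ha.1 hb.1,
        fun σ hσ ↦ by rw [smul_add, ha.2 σ hσ, hb.2 σ hσ]⟩
      zero_mem' := ⟨(geomTorsion W (3 : ℤ)).zero_mem, fun σ _ ↦ smul_zero _⟩
      neg_mem' := fun {a} ha ↦ ⟨(geomTorsion W (3 : ℤ)).neg_mem ha.1,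
        fun σ hσ ↦ by rw [smul_neg, ha.2 σ hσ]⟩ } with hFdef
  have hmemF : ∀ P, P ∈ F ↔ P ∈ geomTorsion W (3 : ℤ) ∧ ∀ σ ∈ absInertia (v.adicCompletion K),
      absGaloisRestrict K (v.adicCompletion K) σ • P = P := fun _ ↦ Iff.rfl
  have hFle : F ≤ geomTorsion W (3 : ℤ) := fun P hP ↦ hP.1
  have hFcard : Nat.card F ∣ 3 :=
    W.natCard_dvd_three_of_absInertia_fixed_of_hasAdditiveReductionAt hadd h3v F hFle
      (fun σ hσ P hP ↦ hP.2 σ hσ)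
  have hP₀F : P₀ ∈ F := ⟨hP₀3, hP₀I⟩
  have hzle : AddSubgroup.zmultiples P₀ ≤ F := AddSubgroup.zmultiples_le_of_mem hP₀F
  have hp3P₀ : 3 • P₀ = 0 := by
    have h := (mem_geomTorsion_iff W (3 : ℤ) P₀).mp hP₀3
    rwa [show (3 : ℤ) = ((3 : ℕ) : ℤ) from rfl, natCast_zsmul] at h
  have hcardz : Nat.card (AddSubgroup.zmultiples P₀) = 3 := by
    rw [Nat.card_zmultiples, addOrderOf_eq_prime hp3P₀ hP₀0]
  haveI : Finite F := Nat.finite_of_card_ne_zero (fun h ↦ by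
    rw [h] at hFcard; exact absurd (Nat.eq_zero_of_zero_dvd hFcard) (by norm_num))
  have hFcard3 : Nat.card F = 3 :=
    le_antisymm (Nat.le_of_dvd (by norm_num) hFcard)
      (hcardz ▸ AddSubgroup.card_le_of_le hzle)
  have hzF : AddSubgroup.zmultiples P₀ = F :=
    AddSubgroup.eq_of_le_of_card_ge hzle (by rw [hFcard3, hcardz])
  exact ⟨F, hFle, hFcard3, fun σ hσ P hP ↦ hP.2 σ hσ, fun P hP hPI ↦ ⟨hP, hPI⟩⟩

end WeierstrassCurve

end
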